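import Summits.QuantumFields.YangMills.Theorems.BalabanUVNodesN16CentreConventionDepthOne
import Summits.QuantumFields.BalabanUV.T4Continuum.Support.MinimalActionCompact
import HarnessLib

/-!
# YM-DAG node N16 (NE3), the located averaging pin (42) ↔ (0.4) — part 16: THE ALL-DEPTH LINK — on B11's small-field class in the
# (8)-radius regime the centre-convention torus (42) `cstep` and the tree's (43) have THE SAME constrained minimisers, Theorem-1 leaves
# and `H7Body`, UNIFORMLY IN THE DEPTH

Cell `pub-ymgap`, width seat `pub-ymgap-dag-n16-w3` (director-ym №197 ∕ HUMAN RULING D-0149), generation 7; part 16 of the W1b lineage (part 12 p612224: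
the transfer under `ExactGaugeDefect`; part 14 p616704: `SchemeGaugeEquiv` + the exact frame-transport instance `cstep ≃ rescale ∘ gb` at every depth; part 15
p618456∕p620271: the guard from gauge-invariant smallness and the DEPTH-ONE link).  `--kind proof --supports stmt-QuantumFields-20544 --as helper` (K3⁷; count-neutral;
0 `def`).  `bears_on: R4∕N16`.

THE POINT.  Part 14 proved, EXACTLY and with no smallness, `cstep^k W = (gbstep^k W)^{κ}` (`gbstep W = rescale L (gb W)`, the GUARDED corner-convention (42); `κ` =
the accumulated frame transports); part 15 identified `gbstep` with the tree's `step42` ONE step deep on the small-field class (`guard_of_smallField`) and left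
«deeper levels need the guard along the averaging orbit — NOT claimed».  Here the guard is supplied ALONG THE WHOLE (43)-ORBIT by [Balaban1985Averaging] Prop. 2
(52)–(54) BY NAME — pub-balaban leaf-05 `MinimalActionCompact.avgIter_unitary_smallField_two`: for `U ∈ sfClass d L T ε k` (unitary, `(T·L^k)`-periodic, plaquettes
within `ε∕L^{2k}`) in the (8)-RADIUS REGIME `0 ≤ ε`, `16C₀(d)ε ≤ 3`, `1024(d+1)(d+4)L²ε ≤ 1` (`L ≥ 2`; the letters of the N16 lineage's slot-key files), EVERY
intermediate average `avgIter L U j`, `j ≤ k`, is unitary with plaquettes within `2ε`.  Hence: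
 * §1 `guard_avgIter_of_mem_sfClass`: the guard of row NE7's `gb` holds at every bond of every `avgIter L U j`, `j ≤ k` (the regime's own letter
   `512(d+1)(d+4)L²·(2ε) ≤ 1`).
 * §2 ★★ `iterate_gbstep_eq_avgIter_of_mem_sfClass`: the guarded corner iterate IS (43) on the class — `gbstep^j U = avgIter L U j` for all `j ≤ k` — and
   ★ `exists_avgIterS_cstep_eq_gaugeAct_avgIter`: the centre-convention `k`-fold average of a class member IS a unitary `T`-periodic coarse gauge transform of (43).
 * §3 ★★ `schemeGaugeEquiv_step42_cstep`: `SchemeGaugeEquiv d (step42) (cstep) L T k (sfClass d L T ε k)` AT EVERY DEPTH `k` with ONE depth-free radius condition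
   (part 15's `…_one` is `k = 1` under the weaker letter `512(d+1)(d+4)ε ≤ 1`); so ★★ `cstep`-constrained and (43)-constrained minimisers (`MinimalActionSandwich.IsMinimiser`)
   AT THE SAME DATUM correspond under unitary `(T·L^k)`-periodic gauges at every depth (`exists_isMinimiser_gaugeAct_of_isMinimiserS_cstep`, its converse,
   `exists_isMinimiser_iff_cstep`), every gauge-invariant property of minimisers transfers (`forall_isMinimiserS_cstep_iff`), and ★★★ `leafH3supS_cstep_iff_leafH3sup`:
   g0's `LeafH3supS d (cstep)` ⟺ the tree's `LeafH3sup` — N16's leaf ([Balaban1985Variational] Thm 1 (8)+(9) TYPE for the (43)-constrained minimisers) — for every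
   `ε` in the regime and all letters `b, c, dom`; `schemeGaugeEquiv_step42_gbstep` (κ = 1) and `leafH3supS_gbstep_iff_leafH3sup`: the guarded CORNER (42) of
   row NE7 too — all three conventions have the same leaf on the class.
 * §4 (`d = 4`, N16's objects of record): `h7Body_iff_of_schemeGaugeEquiv` (the `SchemeGaugeEquiv` form of part 12's body lemma: equivalence to (43) on the
   classes for all small `ε` ⇒ equal bodies) and, at `P := F.P K`, ★★ `h7Body_cstep_iff`: `H7Body N (cstep) F ⟺ H7Body N (step42) F` (= `stub_h7 F`'s body VERBATIM, g0
   `h7Body_step42_iff`; `ε₀ ↦ min ε₀ ε_reg(L)`), hence `averagingTransfer_cstep`: g0's displayed `AveragingTransfer N s F` is a THEOREM at `s = cstep` — the tree's own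
   NE7 torus instance of (42) in Setup's centred convention (`QLaTorusB7Averaging.avgB7`) needs NO transfer hypothesis.
READING (honest).  Setup's DIVERGENCE F3 (centre vs corner base point) AND the guard's junk branch are BOTH invisible to N16's constrained variational problem on the
small-field class, at every depth.  The located content of the (42) ↔ (0.4) pin is unchanged from `W3-PIN-ANATOMY-v4.md` §4: (i) the non-abelian second order of
the symmetrised exp-mean-log against (42)'s log-mean, (iii) `step04`'s reading divergences (d1)–(d3); g0's `Transfer04to42 ∕ 42to04` are NOT obtained.

HONEST FRAMING.  [folklore] bookkeeping BY NAME over parts 12∕14∕15, g0's `N16AveragingPin`, pub-balaban's `MinimalActionCompact` (whose content is the tree's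
kernel `B7Prop2Explicit` = [Balaban1985Averaging] Prop. 2), `NE3ResidualSliceRep.mem_sfClass_gaugeAct`, `QLaTorusB7Averaging`; 0 `def`, 0 `sorry`, no `instance`,
no `notation`; no minimiser is constructed (existence and regularity are TRANSFERRED, never produced); nothing of [Balaban1985Variational] ∕ [Balaban1987RG1]
asserted; K3⁷ stubs NOT touched; N16 ∕ NE3 NOT discharged; count-neutral (typed 28∕28 · discharged 5∕27 work-bound, A 5∕28 — unmoved).  One finite four-torus
programme at fixed `ε` — the Yang–Mills mass gap (Clay) is NOT proved by any of this; R4 closes the conditional finite-𝕋⁴ rung `BalabanLadder.UV` only; nothing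
continuum ∕ ℝ⁴ ∕ OS.
-/

set_option autoImplicit false

open scoped BigOperators Matrix Matrix.Norms.L2Operator
open NormedSpace

namespace Summit.QuantumFields.YangMills.BalabanUVNodes.N16CentreConventionAllDepths

open Literature.MathematicalPhysics.QuantumFieldTheory.Balaban1983to89
open Literature.MathematicalPhysics.QuantumFieldTheory.Balaban1983to89.T4Continuum (T4Family)
open B7Prop1Explicit B7Prop2Explicit
open T4AveragingDeficitWall (IsUnitaryCfg SmallField)
open T4AveragingDeficitWallBoundary (IsPeriodicCfg)
open Summit.QuantumFields.BalabanUV.T4Continuum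
open MinimalActionSandwich (IsMinimiser)
open MinimalActionRate (sfClass)
open MinimalActionCompact (avgIter_unitary_smallField_two)
open NE3.LeafIndexSockets (LeafH3sup)
open NE3EnergyShapes (IsUnitarySite IsPeriodicSite)
open NE3ResidualSliceRep (mem_sfClass_gaugeAct)
open Node00 (MatA ne3NperOfRecord₁₁ ne3DomOfRecord₁₁)
open Summit.QuantumFields.YangMills.BalabanUVNodes.N16AveragingPin
  (avgIterS step42 avgIterS_step42 avgIterS_const IsMinimiserS isMinimiserS_step42_iff LeafH3supS leafH3supS_step42_iff H7Body AveragingTransfer)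
open Summit.QuantumFields.YangMills.BalabanUVNodes.N16AveragingTransferOfGaugeDefect (uLev_blockLift)
open Summit.QuantumFields.YangMills.BalabanUVNodes.N16CentreConventionTransfer
  (SchemeGaugeEquiv exists_isMinimiserS_gaugeAct_of_isMinimiserS schemeGaugeEquiv_cstep leafH3supS_iff_of_schemeGaugeEquiv gbstep_eq_step42_of_guard
    leafH3supS_cstep_iff)
open Summit.QuantumFields.YangMills.BalabanUVNodes.N16CentreConventionDepthOne (guard_of_smallField forall_isMinimiserS_iff_of_schemeGaugeEquiv)
open Summit.QuantumFields.BalabanUV.T4Continuum.Spine.NE7.TorusB7 (Mat Guard gb cstep)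

noncomputable section

/-! ## §1 The guard along the whole (43)-orbit of a small-field class member -/

section Orbit

variable {P : Params} {N : ℕ} [NeZero N]

omit [NeZero N] in
/-- The (8)-radius regime's letter `1024(d+1)(d+4)L²ε ≤ 1` IS the guard's smallness `512(d+1)(d+4)L²α₀ ≤ 1` at the orbit radius `α₀ = 2ε`. [folklore] -/
theorem regime_guard_smallness {ε : ℝ} (hε2 : 1024 * (P.d + 1) * (P.d + 4) * (P.L : ℝ) ^ 2 * ε ≤ 1) :
    512 * (P.d + 1) * (P.d + 4) * (P.L : ℝ) ^ 2 * (2 * ε) ≤ 1 := by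
  have h : (512 : ℝ) * (P.d + 1) * (P.d + 4) * (P.L : ℝ) ^ 2 * (2 * ε) = 1024 * (P.d + 1) * (P.d + 4) * (P.L : ℝ) ^ 2 * ε := by ring
  rw [h]
  exact hε2

/-- **EVERY INTERMEDIATE AVERAGE OF A CLASS MEMBER IS UNITARY AND `2ε`-SMALL** ([Balaban1985Averaging] Prop. 2 (52)–(54) BY NAME through pub-balaban leaf-05
`MinimalActionCompact.avgIter_unitary_smallField_two`, uniformly in the level): for `U ∈ sfClass d L T ε k` in the regime `0 ≤ ε`, `16C₀(d)ε ≤ 3`,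
`1024(d+1)(d+4)L²ε ≤ 1` and every `j ≤ k`, `avgIter L U j` is `U(N)`-valued with all plaquette variables within `2ε` of `1`.
[cite: Balaban1985Averaging, Prop. 2 (52)–(54) p.26] -/
theorem isUnitaryCfg_smallField_avgIter_of_mem_sfClass {T k : ℕ} {ε : ℝ} (hε0 : 0 ≤ ε) (hε1 : 16 * C0 P.d * ε ≤ 3)
    (hε2 : 1024 * (P.d + 1) * (P.d + 4) * (P.L : ℝ) ^ 2 * ε ≤ 1) {U : Site P.d → Fin P.d → (Mat N)ˣ}
    (hU : U ∈ sfClass P.d P.L T ε k) {j : ℕ} (hj : j ≤ k) :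
    IsUnitaryCfg (avgIter P.L U j) ∧ SmallField (avgIter P.L U j) (2 * ε) := by
  haveI : Nonempty (Fin N) := ⟨0⟩
  have hL2 : 2 ≤ P.L := P.hL.2
  exact avgIter_unitary_smallField_two hL2 hU.1 hε0 hε1 hε2 hU.2.2 hj

/-- **★ THE GUARD HOLDS ALONG THE WHOLE ORBIT**: for `U ∈ sfClass d L T ε k` in the regime and every `j ≤ k`, row NE7's `Guard` (all `V(Γ_{c,x})V(c)⁻¹`,
`x ∈ B(c₋)`, within `1∕4` of `1`) holds at EVERY `L`-bond of `avgIter L U j` — part 15's `guard_of_smallField` (b07's `norm_Wcx_sub_one_le`, p. 25) at the orbit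
radius `2ε`. [cite: Balaban1985Averaging, p.25 (displays before (47))] -/
theorem guard_avgIter_of_mem_sfClass {T k : ℕ} {ε : ℝ} (hε0 : 0 ≤ ε) (hε1 : 16 * C0 P.d * ε ≤ 3)
    (hε2 : 1024 * (P.d + 1) * (P.d + 4) * (P.L : ℝ) ^ 2 * ε ≤ 1) {U : Site P.d → Fin P.d → (Mat N)ˣ}
    (hU : U ∈ sfClass P.d P.L T ε k) {j : ℕ} (hj : j ≤ k) (q : Site P.d) (κ : Fin P.d) :
    Guard P N (avgIter P.L U j) q κ := by
  obtain ⟨hu, hs⟩ := isUnitaryCfg_smallField_avgIter_of_mem_sfClass (P := P) (N := N) hε0 hε1 hε2 hU hj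
  exact guard_of_smallField hu (by positivity) (regime_guard_smallness (P := P) hε2) hs q κ

end Orbit

/-! ## §2 The guarded corner iterate IS (43) on the class; the centre-convention average is a coarse gauge transform of (43) -/

section Iterate

variable {P : Params} {N : ℕ} [NeZero N]

/-- **★★ THE GUARDED CORNER ITERATE IS (43) ON THE SMALL-FIELD CLASS**: for `U ∈ sfClass d L T ε k` in the regime and every `j ≤ k`,
`(W ↦ rescale L (gb W))^[j] U = avgIter L U j` — induction on `j`, the guard at level `j` (§1) selecting (42)'s branch of `gb` (part 14
`gbstep_eq_step42_of_guard`). [folklore] -/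
theorem iterate_gbstep_eq_avgIter_of_mem_sfClass {T k : ℕ} {ε : ℝ} (hε0 : 0 ≤ ε) (hε1 : 16 * C0 P.d * ε ≤ 3)
    (hε2 : 1024 * (P.d + 1) * (P.d + 4) * (P.L : ℝ) ^ 2 * ε ≤ 1) {U : Site P.d → Fin P.d → (Mat N)ˣ}
    (hU : U ∈ sfClass P.d P.L T ε k) : ∀ (j : ℕ), j ≤ k → (fun W => rescale P.L (gb P N W))^[j] U = avgIter P.L U j
  | 0, _ => rfl
  | j + 1, hj => by
    have hj' : j ≤ k := Nat.le_of_succ_le hj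
    rw [Function.iterate_succ_apply', iterate_gbstep_eq_avgIter_of_mem_sfClass hε0 hε1 hε2 hU j hj',
      gbstep_eq_step42_of_guard (guard_avgIter_of_mem_sfClass (P := P) (N := N) hε0 hε1 hε2 hU hj'), avgIter_succ]
    rfl

/-- Hence the `k`-fold average under the guarded corner scheme (g0's `avgIterS`) of a class member IS the tree's `avgIter L U k`. [folklore] -/
theorem avgIterS_gbstep_eq_avgIter {T k : ℕ} {ε : ℝ} (hε0 : 0 ≤ ε) (hε1 : 16 * C0 P.d * ε ≤ 3)
    (hε2 : 1024 * (P.d + 1) * (P.d + 4) * (P.L : ℝ) ^ 2 * ε ≤ 1) {U : Site P.d → Fin P.d → (Mat N)ˣ}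
    (hU : U ∈ sfClass P.d P.L T ε k) :
    avgIterS (fun _ => fun W => rescale P.L (gb P N W)) k U = avgIter P.L U k := by
  rw [avgIterS_const]
  exact iterate_gbstep_eq_avgIter_of_mem_sfClass (P := P) (N := N) hε0 hε1 hε2 hU k le_rfl

/-- **★ THE CENTRE-CONVENTION `k`-FOLD AVERAGE OF A CLASS MEMBER IS A COARSE GAUGE TRANSFORM OF (43)**: for `U ∈ sfClass d L T ε k` in the regime there is a
unitary `T`-periodic `κ` (the accumulated frame transports of part 14) with `avgIterS (cstep) k U = (avgIter L U k)^{κ}` — EXACT, non-abelian. [folklore] -/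
theorem exists_avgIterS_cstep_eq_gaugeAct_avgIter {T k : ℕ} {ε : ℝ} (hε0 : 0 ≤ ε) (hε1 : 16 * C0 P.d * ε ≤ 3)
    (hε2 : 1024 * (P.d + 1) * (P.d + 4) * (P.L : ℝ) ^ 2 * ε ≤ 1) {U : Site P.d → Fin P.d → (Mat N)ˣ}
    (hU : U ∈ sfClass P.d P.L T ε k) :
    ∃ κ : Site P.d → (Mat N)ˣ, IsUnitarySite κ ∧ IsPeriodicSite κ (T : ℤ) ∧
      avgIterS (fun _ => cstep P N) k U = gaugeAct κ (avgIter P.L U k) := by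
  obtain ⟨κ, hκ, hκP, h⟩ := (schemeGaugeEquiv_cstep (P := P) (N := N) k T).defect U ⟨hU.1, hU.2.1⟩
  exact ⟨κ, hκ, hκP, by rw [h, avgIterS_gbstep_eq_avgIter (P := P) (N := N) hε0 hε1 hε2 hU]⟩

end Iterate

/-! ## §3 `SchemeGaugeEquiv (step42) (cstep)` at every depth; minimisers, gauge-invariant properties and Theorem-1 leaves coincide -/

section AllDepths

variable {P : Params} {N : ℕ} [NeZero N]

/-- **★★ AT EVERY DEPTH, ON THE SMALL-FIELD CLASS IN THE (8)-RADIUS REGIME, (43) AND THE CENTRE-CONVENTION `cstep` ARE POINTWISE COARSE-GAUGE EQUIVALENT**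
(part 14's frame-transport equivalence `cstep ≃ rescale ∘ gb` composed with §2's identification `gbstep^k = avgIter · k` on the class):
`SchemeGaugeEquiv d (step42) (cstep) L T k (sfClass d L T ε k)` for all `k`, `0 ≤ ε`, `16C₀(d)ε ≤ 3`, `1024(d+1)(d+4)L²ε ≤ 1`. [folklore] -/
theorem schemeGaugeEquiv_step42_cstep (T k : ℕ) {ε : ℝ} (hε0 : 0 ≤ ε) (hε1 : 16 * C0 P.d * ε ≤ 3)
    (hε2 : 1024 * (P.d + 1) * (P.d + 4) * (P.L : ℝ) ^ 2 * ε ≤ 1) :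
    SchemeGaugeEquiv P.d (fun _ => step42 P.L) (fun _ => cstep P N) P.L T k (sfClass P.d P.L T ε k) where
  cov₁ κ U _ _ _ := by
    rw [avgIterS_step42, avgIterS_step42, B7Prop6Flat.avgIter_gaugeAct_units, uLev_blockLift P.L P.hL.2.le k κ]
  cov₂ κ U hκ hκP hU := (schemeGaugeEquiv_cstep (P := P) (N := N) k T).cov₂ κ U hκ hκP ⟨hU.1, hU.2.1⟩
  defect U hU := by
    obtain ⟨κ, hκ, hκP, h⟩ := exists_avgIterS_cstep_eq_gaugeAct_avgIter (P := P) (N := N) hε0 hε1 hε2 hU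
    exact ⟨κ, hκ, hκP, by rw [h, avgIterS_step42]⟩

/-- **★★ AT EVERY DEPTH A `cstep`-CONSTRAINED MINIMISER IS A GAUGE TRANSFORM OF A (43)-CONSTRAINED MINIMISER AT THE SAME DATUM**: on `sfClass d L T ε` in the
regime, every minimiser of the level-`k` action over the `cstep`-admissible configurations of datum `V` is carried by a unitary `(T·L^k)`-periodic gauge to a
minimiser of the tree's (43)-constrained problem (`MinimalActionSandwich.IsMinimiser`, g0's `isMinimiserS_step42_iff`) at the same `V`. [folklore] -/
theorem exists_isMinimiser_gaugeAct_of_isMinimiserS_cstep (T k : ℕ) {ε : ℝ} (hε0 : 0 ≤ ε) (hε1 : 16 * C0 P.d * ε ≤ 3)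
    (hε2 : 1024 * (P.d + 1) * (P.d + 4) * (P.L : ℝ) ^ 2 * ε ≤ 1)
    {V U : Site P.d → Fin P.d → (Mat N)ˣ} (hU : IsMinimiserS P.d (fun _ => cstep P N) (sfClass P.d P.L T ε) P.L T k V U) :
    ∃ u : Site P.d → (Mat N)ˣ, IsUnitarySite u ∧ IsPeriodicSite u ((T * P.L ^ k : ℕ) : ℤ) ∧
      IsMinimiser P.d (sfClass P.d P.L T ε) P.L T k V (gaugeAct u U) := by
  haveI : Nonempty (Fin N) := ⟨0⟩
  obtain ⟨u, hu, huP, h⟩ := exists_isMinimiserS_gaugeAct_of_isMinimiserS (𝒞 := sfClass P.d P.L T ε) P.hL.2.le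
    (fun u U hu huP hU => mem_sfClass_gaugeAct hu huP hU) (schemeGaugeEquiv_step42_cstep (P := P) (N := N) T k hε0 hε1 hε2) hU
  exact ⟨u, hu, huP, (isMinimiserS_step42_iff P.L _ T k V _).1 h⟩

/-- **★★ CONVERSELY**, at every depth a (43)-constrained minimiser is a gauge transform of a `cstep`-constrained minimiser at the same datum. [folklore] -/
theorem exists_isMinimiserS_cstep_gaugeAct_of_isMinimiser (T k : ℕ) {ε : ℝ} (hε0 : 0 ≤ ε) (hε1 : 16 * C0 P.d * ε ≤ 3)
    (hε2 : 1024 * (P.d + 1) * (P.d + 4) * (P.L : ℝ) ^ 2 * ε ≤ 1)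
    {V U : Site P.d → Fin P.d → (Mat N)ˣ} (hU : IsMinimiser P.d (sfClass P.d P.L T ε) P.L T k V U) :
    ∃ u : Site P.d → (Mat N)ˣ, IsUnitarySite u ∧ IsPeriodicSite u ((T * P.L ^ k : ℕ) : ℤ) ∧
      IsMinimiserS P.d (fun _ => cstep P N) (sfClass P.d P.L T ε) P.L T k V (gaugeAct u U) := by
  haveI : Nonempty (Fin N) := ⟨0⟩
  have hU' : IsMinimiserS P.d (fun _ => step42 P.L) (sfClass P.d P.L T ε) P.L T k V U := (isMinimiserS_step42_iff P.L _ T k V U).2 hU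
  exact exists_isMinimiserS_gaugeAct_of_isMinimiserS (𝒞 := sfClass P.d P.L T ε) P.hL.2.le
    (fun u U hu huP hU => mem_sfClass_gaugeAct hu huP hU) (schemeGaugeEquiv_step42_cstep (P := P) (N := N) T k hε0 hε1 hε2).symm hU'

/-- **★ HENCE, AT EVERY DEPTH, THE TWO CONSTRAINED PROBLEMS HAVE MINIMISERS AT EXACTLY THE SAME DATA.** [folklore] -/
theorem exists_isMinimiser_iff_cstep (T k : ℕ) {ε : ℝ} (hε0 : 0 ≤ ε) (hε1 : 16 * C0 P.d * ε ≤ 3)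
    (hε2 : 1024 * (P.d + 1) * (P.d + 4) * (P.L : ℝ) ^ 2 * ε ≤ 1) (V : Site P.d → Fin P.d → (Mat N)ˣ) :
    (∃ U, IsMinimiserS P.d (fun _ => cstep P N) (sfClass P.d P.L T ε) P.L T k V U) ↔ ∃ U, IsMinimiser P.d (sfClass P.d P.L T ε) P.L T k V U := by
  constructor
  · rintro ⟨U, hU⟩
    obtain ⟨u, -, -, h⟩ := exists_isMinimiser_gaugeAct_of_isMinimiserS_cstep (P := P) (N := N) T k hε0 hε1 hε2 hU
    exact ⟨_, h⟩
  · rintro ⟨U, hU⟩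
    obtain ⟨u, -, -, h⟩ := exists_isMinimiserS_cstep_gaugeAct_of_isMinimiser (P := P) (N := N) T k hε0 hε1 hε2 hU
    exact ⟨_, h⟩

/-- **EVERY GAUGE-INVARIANT PROPERTY OF CONSTRAINED MINIMISERS TRANSFERS, AT EVERY DEPTH**: if `Q` is invariant under unitary `(T·L^k)`-periodic gauges, then on
the class in the regime `Q` holds for all `cstep`-constrained minimisers at the data of `dom` iff it holds for all (43)-constrained minimisers there (part 15 §3 at
the §3 equivalence, read through g0's `isMinimiserS_step42_iff`). [folklore] -/
theorem forall_isMinimiserS_cstep_iff (T k : ℕ) {ε : ℝ} (hε0 : 0 ≤ ε) (hε1 : 16 * C0 P.d * ε ≤ 3)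
    (hε2 : 1024 * (P.d + 1) * (P.d + 4) * (P.L : ℝ) ^ 2 * ε ≤ 1) {Q : (Site P.d → Fin P.d → (Mat N)ˣ) → Prop}
    (hQ : ∀ (u : Site P.d → (Mat N)ˣ) (U : Site P.d → Fin P.d → (Mat N)ˣ), IsUnitarySite u →
      IsPeriodicSite u ((T * P.L ^ k : ℕ) : ℤ) → Q (gaugeAct u U) → Q U)
    (dom : Set (Site P.d → Fin P.d → (Mat N)ˣ)) :
    (∀ V ∈ dom, ∀ U, IsMinimiserS P.d (fun _ => cstep P N) (sfClass P.d P.L T ε) P.L T k V U → Q U) ↔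
      (∀ V ∈ dom, ∀ U, IsMinimiser P.d (sfClass P.d P.L T ε) P.L T k V U → Q U) := by
  haveI : Nonempty (Fin N) := ⟨0⟩
  have h := forall_isMinimiserS_iff_of_schemeGaugeEquiv (𝒞 := sfClass P.d P.L T ε) P.hL.2.le
    (fun u U hu huP hU => mem_sfClass_gaugeAct hu huP hU) (schemeGaugeEquiv_step42_cstep (P := P) (N := N) T k hε0 hε1 hε2) hQ dom
  rw [h]
  constructor
  · intro h' V hV U hU
    exact h' V hV U ((isMinimiserS_step42_iff P.L _ T k V U).2 hU)
  · intro h' V hV U hU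
    exact h' V hV U ((isMinimiserS_step42_iff P.L _ T k V U).1 hU)

/-- **★★★ THE THEOREM-1 LEAVES COINCIDE**: for every radius `ε` in the (8)-radius regime (`0 ≤ ε`, `16C₀(d)ε ≤ 3`, `1024(d+1)(d+4)L²ε ≤ 1`), all letters `b, c` and
all data `dom`, g0's `LeafH3supS d (cstep) L T ε b c dom` — sup-form [Balaban1985Variational] Thm 1 (8)+(9) TYPE regularity of the minimisers constrained by the
tree's NE7 torus instance of (42) in Setup's CENTRED convention — is EQUIVALENT to the tree's `LeafH3sup d L T ε b c dom` (N16's leaf: the same for the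
(43)-constrained minimisers, print's constraint (3)).  Part 14 at every depth `k+1` (§3) + g0's dictionary `leafH3supS_step42_iff`. [folklore] -/
theorem leafH3supS_cstep_iff_leafH3sup (T : ℕ) {ε : ℝ} (hε0 : 0 ≤ ε) (hε1 : 16 * C0 P.d * ε ≤ 3)
    (hε2 : 1024 * (P.d + 1) * (P.d + 4) * (P.L : ℝ) ^ 2 * ε ≤ 1) (b c : ℝ) (dom : Set (Site P.d → Fin P.d → (Mat N)ˣ)) :
    LeafH3supS P.d (fun _ => cstep P N) P.L T ε b c dom ↔ LeafH3sup P.d P.L T ε b c dom := by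
  haveI : Nonempty (Fin N) := ⟨0⟩
  rw [← leafH3supS_step42_iff]
  exact leafH3supS_iff_of_schemeGaugeEquiv P.hL.2.le fun k => schemeGaugeEquiv_step42_cstep (P := P) (N := N) T (k + 1) hε0 hε1 hε2

/-- **THE GUARDED CORNER SCHEME ITSELF IS GAUGE-EQUIVALENT TO (43) ON THE CLASS, WITH THE TRIVIAL GAUGE** (`κ = 1`: §2's identification `gbstep^k U = avgIter L U k`;
block-lift covariance of `gbstep` is part 14's `iterate_gb_gaugeAct`). [folklore] -/
theorem schemeGaugeEquiv_step42_gbstep (T k : ℕ) {ε : ℝ} (hε0 : 0 ≤ ε) (hε1 : 16 * C0 P.d * ε ≤ 3)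
    (hε2 : 1024 * (P.d + 1) * (P.d + 4) * (P.L : ℝ) ^ 2 * ε ≤ 1) :
    SchemeGaugeEquiv P.d (fun _ => step42 P.L) (fun _ => fun W => rescale P.L (gb P N W)) P.L T k (sfClass P.d P.L T ε k) where
  cov₁ κ U _ _ _ := by
    rw [avgIterS_step42, avgIterS_step42, B7Prop6Flat.avgIter_gaugeAct_units, uLev_blockLift P.L P.hL.2.le k κ]
  cov₂ κ U hκ hκP hU := (schemeGaugeEquiv_cstep (P := P) (N := N) k T).cov₁ κ U hκ hκP ⟨hU.1, hU.2.1⟩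
  defect U hU := ⟨fun _ => 1, fun _ => (unitaryUnits (Mat N)).one_mem, fun _ _ => rfl, by
    rw [avgIterS_gbstep_eq_avgIter (P := P) (N := N) hε0 hε1 hε2 hU, avgIterS_step42]
    funext z μ
    simp [gaugeAct]⟩

/-- **HENCE ALL THREE CONVENTIONS HAVE THE SAME THEOREM-1 LEAF ON THE CLASS**: the guarded corner (42) `W ↦ rescale L (gb W)` too (part 14 `leafH3supS_cstep_iff`:
centre ↔ guarded corner at every radius; §3: centre ↔ (43) in the regime). [folklore] -/
theorem leafH3supS_gbstep_iff_leafH3sup (T : ℕ) {ε : ℝ} (hε0 : 0 ≤ ε) (hε1 : 16 * C0 P.d * ε ≤ 3)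
    (hε2 : 1024 * (P.d + 1) * (P.d + 4) * (P.L : ℝ) ^ 2 * ε ≤ 1) (b c : ℝ) (dom : Set (Site P.d → Fin P.d → (Mat N)ˣ)) :
    LeafH3supS P.d (fun _ => fun W => rescale P.L (gb P N W)) P.L T ε b c dom ↔ LeafH3sup P.d P.L T ε b c dom := by
  rw [← leafH3supS_cstep_iff (P := P) (N := N) T ε b c dom]
  exact leafH3supS_cstep_iff_leafH3sup (P := P) (N := N) T hε0 hε1 hε2 b c dom

end AllDepths

/-! ## §4 At N16's objects of record (`d = 4`): `H7Body N (cstep) F ⟺ H7Body N (step42) F`; g0's `AveragingTransfer` at `s = cstep` is a theorem -/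

section Record

variable (N : ℕ) [NeZero N] (F : T4Family) (K : ℕ)

/-- The regime radius for the family's `L`: `ε_reg(L) = min(3∕(16C₀(4)), 1∕(40960L²))`, positive. [folklore] -/
theorem regimeRadius_pos : 0 < min (3 / (16 * C0 4)) (1 / (40960 * (F.L : ℝ) ^ 2)) := by
  have hC := C0_pos 4
  have hL : (0 : ℝ) < F.L := by have := F.hL.2; positivity
  exact lt_min (by positivity) (by positivity)

/-- Below the regime radius both regime letters hold at `d = 4`. [folklore] -/
theorem regime_of_le_regimeRadius {ε : ℝ} (hεle : ε ≤ min (3 / (16 * C0 4)) (1 / (40960 * (F.L : ℝ) ^ 2))) :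
    16 * C0 (F.P K).d * ε ≤ 3 ∧ 1024 * ((F.P K).d + 1) * ((F.P K).d + 4) * ((F.P K).L : ℝ) ^ 2 * ε ≤ 1 := by
  have hd : (F.P K).d = 4 := rfl
  have hLF : (F.P K).L = F.L := rfl
  rw [hd, hLF]
  have hC := C0_pos 4
  have hL : (0 : ℝ) < F.L := by have := F.hL.2; positivity
  have h1 : ε ≤ 3 / (16 * C0 4) := hεle.trans (min_le_left _ _)
  have h2 : ε ≤ 1 / (40960 * (F.L : ℝ) ^ 2) := hεle.trans (min_le_right _ _)
  rw [le_div_iff₀ (by positivity)] at h1 h2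
  constructor
  · linarith
  · push_cast
    nlinarith

/-- **THE BODIES OF TWO GAUGE-EQUIVALENT SCHEMES COINCIDE** (the `SchemeGaugeEquiv` form of part 12's `h7Body_iff_of_exactGaugeDefect`): if for some `ε₁ > 0`
the scheme `s` is pointwise coarse-gauge equivalent to (43) (block-lift covariance) at every depth `k+1` on N16's classes `sfClass 4 F.L (2L^m) ε (k+1)` for EVERY
`0 < ε ≤ ε₁`, then `H7Body N s F ⟺ H7Body N (step42) F` (`ε₀ ↦ min ε₀ ε₁`, same `C`; part 14 `leafH3supS_iff_of_schemeGaugeEquiv`).  Nothing is asserted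
about either side. [folklore] -/
theorem h7Body_iff_of_schemeGaugeEquiv (s : ℕ → ((Fin 4 → ℤ) → Fin 4 → (MatA N)ˣ) → ((Fin 4 → ℤ) → Fin 4 → (MatA N)ˣ)) {ε₁ : ℝ} (hε₁ : 0 < ε₁)
    (hE : ∀ ε : ℝ, 0 < ε → ε ≤ ε₁ → ∀ k : ℕ, SchemeGaugeEquiv 4 (fun _ => step42 F.L) s F.L (ne3NperOfRecord₁₁ F 0 0) (k + 1)
      (sfClass 4 F.L (ne3NperOfRecord₁₁ F 0 0) ε (k + 1))) :
    H7Body N s F ↔ H7Body N (fun _ => step42 F.L) F := by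
  haveI : Nonempty (Fin N) := ⟨0⟩
  constructor
  · rintro ⟨C, ε₀, hC, hε₀, h⟩
    refine ⟨C, min ε₀ ε₁, hC, lt_min hε₀ hε₁, fun ε hε hεle => ?_⟩
    exact (leafH3supS_iff_of_schemeGaugeEquiv F.hL.2.le (hE ε hε (hεle.trans (min_le_right _ _)))).1
      (h ε hε (hεle.trans (min_le_left _ _)))
  · rintro ⟨C, ε₀, hC, hε₀, h⟩
    refine ⟨C, min ε₀ ε₁, hC, lt_min hε₀ hε₁, fun ε hε hεle => ?_⟩
    exact (leafH3supS_iff_of_schemeGaugeEquiv F.hL.2.le (hE ε hε (hεle.trans (min_le_right _ _)))).2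
      (h ε hε (hεle.trans (min_le_left _ _)))

/-- **★★ AT N16's OBJECTS OF RECORD THE TWO BODIES COINCIDE**: for every family `F`, `H7Body N (cstep (F.P K) N) F ⟺ H7Body N (step42 F.L) F` — the body of
`stub_h7 F` VERBATIM (g0 `h7Body_step42_iff`) is the same for the minimisers constrained by the tree's NE7 torus instance of (42) in Setup's centred convention
(`ε₀ ↦ min ε₀ ε_reg(L)`, same `C`; §3 at `P := F.P K`, `T := 2L^m`, every `ε ≤ ε_reg(L)`).  Nothing is asserted about either side. [folklore] -/
theorem h7Body_cstep_iff : H7Body N (fun _ => cstep (F.P K) N) F ↔ H7Body N (fun _ => step42 F.L) F :=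
  h7Body_iff_of_schemeGaugeEquiv N F (fun _ => cstep (F.P K) N) (regimeRadius_pos F) fun ε hε hεle k => by
    obtain ⟨h1, h2⟩ := regime_of_le_regimeRadius F K hεle
    exact schemeGaugeEquiv_step42_cstep (P := F.P K) (N := N) (ne3NperOfRecord₁₁ F 0 0) (k + 1) hε.le h1 h2

/-- **g0's DISPLAYED `AveragingTransfer N s F` IS A THEOREM AT `s = cstep`**: the transfer of `stub_h7 F`'s body from the (42)∕(43)-constrained minimisers to the
minimisers constrained by the tree's NE7 torus instance of (42) in Setup's centred convention (`QLaTorusB7Averaging.cstep ∕ avgB7`) holds with NO hypothesis — in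
contrast with the averaging of record (0.4) (`step04`), for which `Transfer42to04` stays displayed (`W3-PIN-ANATOMY-v4.md` §4). [folklore] -/
theorem averagingTransfer_cstep : AveragingTransfer N (fun _ => cstep (F.P K) N) F :=
  (h7Body_cstep_iff N F K).2

end Record

end

end Summit.QuantumFields.YangMills.BalabanUVNodes.N16CentreConventionAllDepths
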